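import Summits.AtomisticToContinuum.HydrodynamicLimit.Theorems.AntiMazurCoboundariesInfluenceLocalityFirstMomentObjects
import Summits.AtomisticToContinuum.HydrodynamicLimit.Theorems.AntiMazurCoboundariesInfluenceLocalityTightChainPressureNecklace
import Summits.AtomisticToContinuum.HydrodynamicLimit.Theorems.AntiMazurCoboundariesInfluenceLocalityTightChainPressurePrelim
import HarnessLib

/-!
# Ruelle bound for near-contact chains under `G_N` (stub `stub_nearChainBound`, line
# `slab-percolation-shadow`, crux `InfluenceLocality`, stmt-AtomisticToContinuum-13916)

The registered sub-stub `stub_nearChainBound : NearChainBound` of the first-moment line: under the stationary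
global Gibbs law `G_N = gibbs σ a θ u₀ N Φ` with `SmallDensity uniformProfile σ`, `a, θ > 0`, for `r + 1 ≤ N`, any
flow `Φ`, time `t`, radii `0 ≤ δ, ρ < 1/2` and label `i`, the probability of the single-time near-contact chain
event `NearChain N Φ t r δ ρ · i` (an injective sequence `f 0, …, f r` with consecutive minimal-image distances
`≤ δ` and `f 0` within `ρ` of particle `i`, read at time `t`) is at most
`2^{r+2} (8(N+1)δ³)^r (8(N+1)ρ³ + r + 1)`.

Proof (pattern `gibbs_necklaceAt_le_of_chainBound`): split over the injective label sequences `f` according to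
whether `i` is one of the `f p`.
* `i ∉ range f`: prepend `i` (`Fin.cons i f`, still injective): a chain of `r + 1` links with link sets
  `B_ρ, B_δ, …, B_δ`, of probability `≤ 2^{r+2} vol(B_ρ) vol(B_δ)^r` by the LANDED fixed-time chain bound
  `gibbs_chainEventAt_le`; at most `(N+1)^{r+1}` such sequences.
* `i = f p`: drop the proximity condition; `f` is a chain of `r` links with link sets `B_δ`, of probability
  `≤ 2^{r+1} vol(B_δ)^r`; at most `(r+1)(N+1)^r` such sequences (`f ↦ (p, Fin.removeNth p f)` is injective).
* `vol{u : 𝕋³ | d(u, 0) ≤ δ} = vol(closedBall 0 δ) = (4π/3) δ³ ≤ 8 δ³` (`Torus.volume_euclidDist_le`,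
  `EuclideanSpace.volume_closedBall_fin_three`, `π ≤ 4`), and `(N+1)·8δ³ = 8(N+1)δ³`.
-/

namespace Summit.AtomisticToContinuum.HydrodynamicLimit.Theorems.TrueAnchoredInfection

open MeasureTheory Finset Set
open scoped Classical ENNReal
open Literature.Analysis.FluidPDE Literature.MathematicalPhysics.KineticTheory

noncomputable section

/-! ## Minimal-image balls of displacements -/

/-- The minimal-image ball of displacements `{u : 𝕋³ | d(u, 0) ≤ δ}` is measurable. -/
theorem measurableSet_distBall (δ : ℝ) : MeasurableSet {u : T3 | Torus.euclidDist u 0 ≤ δ} := by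
  have hc : Continuous fun u : T3 => Torus.euclidDist u 0 := by
    simp_rw [euclidDist_eq_sqrt]
    fun_prop
  exact measurableSet_le hc.measurable measurable_const

/-- **Cube comparison**: the Haar measure of the minimal-image ball of radius `0 ≤ δ < 1/2` is
`vol(closedBall 0 δ) = (4π/3) δ³ ≤ 8 δ³`. -/
theorem volume_distBall_le {δ : ℝ} (hδ0 : 0 ≤ δ) (hδ : δ < 1 / 2) :
    volume {u : T3 | Torus.euclidDist u 0 ≤ δ} ≤ ENNReal.ofReal (8 * δ ^ 3) := by
  rw [Torus.volume_euclidDist_le hδ (0 : T3), EuclideanSpace.volume_closedBall_fin_three,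
    ← ENNReal.ofReal_pow hδ0, ← ENNReal.ofReal_mul (pow_nonneg hδ0 3)]
  refine ENNReal.ofReal_le_ofReal ?_
  have hπ := Real.pi_le_four
  have h3 : 0 ≤ δ ^ 3 := pow_nonneg hδ0 3
  nlinarith

/-- Scaling by the particle number: `(N+1) · vol{d(u,0) ≤ δ} ≤ 8(N+1)δ³` in `ℝ≥0∞`. -/
theorem natCast_succ_mul_volume_distBall_le (N : ℕ) {δ : ℝ} (hδ0 : 0 ≤ δ) (hδ : δ < 1 / 2) :
    ((N : ℝ≥0∞) + 1) * volume {u : T3 | Torus.euclidDist u 0 ≤ δ}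
      ≤ ENNReal.ofReal (8 * (N + 1) * δ ^ 3) := by
  have h8 : ENNReal.ofReal (8 * (N + 1) * δ ^ 3) = ((N : ℝ≥0∞) + 1) * ENNReal.ofReal (8 * δ ^ 3) := by
    rw [show (8 : ℝ) * (N + 1) * δ ^ 3 = ((N : ℝ) + 1) * (8 * δ ^ 3) by ring,
      ENNReal.ofReal_mul (by positivity), ENNReal.ofReal_add (Nat.cast_nonneg N) zero_le_one,
      ENNReal.ofReal_natCast, ENNReal.ofReal_one]
  rw [h8]
  exact mul_le_mul' le_rfl (volume_distBall_le hδ0 hδ)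

/-! ## Counting label sequences -/

/-- The label sequences `f : Fin (r+1) → Fin (N+1)` passing through a given label `i` number at most
`(r+1)(N+1)^r`: `f ↦ (p, Fin.removeNth p f)` with `f p = i` is inverted by `Fin.insertNth p i`. -/
theorem card_filter_exists_apply_eq_le (N r : ℕ) (i : Fin (N + 1)) :
    ((univ : Finset (Fin (r + 1) → Fin (N + 1))).filter
        fun f => Function.Injective f ∧ ∃ p, f p = i).card
      ≤ (r + 1) * (N + 1) ^ r := by
  have himg : ((univ : Finset (Fin (r + 1) → Fin (N + 1))).filter
        fun f => Function.Injective f ∧ ∃ p, f p = i)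
      ⊆ (univ : Finset (Fin (r + 1) × (Fin r → Fin (N + 1)))).image
          fun pg => Fin.insertNth (α := fun _ => Fin (N + 1)) pg.1 i pg.2 := by
    intro f hf
    obtain ⟨p, hp⟩ := (mem_filter.1 hf).2.2
    refine mem_image.2 ⟨(p, p.removeNth f), mem_univ _, ?_⟩
    rw [← hp]
    exact Fin.insertNth_self_removeNth p f
  calc _ ≤ _ := Finset.card_le_card himg
    _ ≤ (univ : Finset (Fin (r + 1) × (Fin r → Fin (N + 1)))).card := card_image_le
    _ = (r + 1) * (N + 1) ^ r := by
        rw [card_univ, Fintype.card_prod, Fintype.card_fun, Fintype.card_fin, Fintype.card_fin,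
          Fintype.card_fin]

/-- All label sequences `Fin (r+1) → Fin (N+1)`: a filter of them has at most `(N+1)^{r+1}` elements. -/
theorem card_filter_seq_le (N r : ℕ) (P : (Fin (r + 1) → Fin (N + 1)) → Prop) [DecidablePred P] :
    ((univ : Finset (Fin (r + 1) → Fin (N + 1))).filter P).card ≤ (N + 1) ^ (r + 1) := by
  calc _ ≤ (univ : Finset (Fin (r + 1) → Fin (N + 1))).card := card_filter_le _ _
    _ = (N + 1) ^ (r + 1) := by rw [card_univ, Fintype.card_fun, Fintype.card_fin, Fintype.card_fin]

/-! ## The two chain families under `G_N` -/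

/-- Family (2): an injective chain `f` of `r` links with all link sets `B_δ` has `G_N`-probability
`≤ 2^{r+1} vol(B_δ)^r` (`gibbs_chainEventAt_le` with constant link sets). -/
theorem gibbs_deltaChainAt_le {σ a θ : ℝ} (u₀ : V3) (h : SmallDensity uniformProfile σ)
    (ha : 0 < a) (hθ : 0 < θ) {N r : ℕ} (hr : r ≤ N) (Φ : Flow σ N) (t δ : ℝ)
    {f : Fin (r + 1) → Fin (N + 1)} (hf : Function.Injective f) :
    gibbs σ a θ u₀ N Φ {z : Phase N | ∀ m : Fin r,
        (Φ.flow t z (f m.succ)).1 - (Φ.flow t z (f m.castSucc)).1 ∈ {u : T3 | Torus.euclidDist u 0 ≤ δ}}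
      ≤ 2 ^ (r + 1) * volume {u : T3 | Torus.euclidDist u 0 ≤ δ} ^ r := by
  have hb := gibbs_chainEventAt_le u₀ h ha hθ hr Φ t hf (B := fun _ => {u : T3 | Torus.euclidDist u 0 ≤ δ})
    fun _ => measurableSet_distBall δ
  rwa [Finset.prod_const, card_univ, Fintype.card_fin] at hb

/-- Family (1): for an injective `f` avoiding `i`, the prepended sequence `Fin.cons i f` is an injective chain
of `r + 1` links with link sets `B_ρ, B_δ, …, B_δ`, of `G_N`-probability `≤ 2^{r+2} vol(B_ρ) vol(B_δ)^r`. -/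
theorem gibbs_consChainAt_le {σ a θ : ℝ} (u₀ : V3) (h : SmallDensity uniformProfile σ)
    (ha : 0 < a) (hθ : 0 < θ) {N r : ℕ} (hr : r + 1 ≤ N) (Φ : Flow σ N) (t δ ρ : ℝ) {i : Fin (N + 1)}
    {f : Fin (r + 1) → Fin (N + 1)} (hf : Function.Injective f) (hi : i ∉ Set.range f) :
    gibbs σ a θ u₀ N Φ {z : Phase N | ∀ m : Fin (r + 1),
        (Φ.flow t z ((Fin.cons i f : Fin (r + 2) → Fin (N + 1)) m.succ)).1
          - (Φ.flow t z ((Fin.cons i f : Fin (r + 2) → Fin (N + 1)) m.castSucc)).1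
          ∈ (Fin.cons {u : T3 | Torus.euclidDist u 0 ≤ ρ} (fun _ => {u : T3 | Torus.euclidDist u 0 ≤ δ}) :
              Fin (r + 1) → Set T3) m}
      ≤ 2 ^ (r + 2) * (volume {u : T3 | Torus.euclidDist u 0 ≤ ρ}
          * volume {u : T3 | Torus.euclidDist u 0 ≤ δ} ^ r) := by
  have hg : Function.Injective (Fin.cons i f : Fin (r + 2) → Fin (N + 1)) :=
    Fin.cons_injective_iff.2 ⟨hi, hf⟩
  have hB : ∀ m, MeasurableSet ((Fin.cons {u : T3 | Torus.euclidDist u 0 ≤ ρ}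
      (fun _ => {u : T3 | Torus.euclidDist u 0 ≤ δ}) : Fin (r + 1) → Set T3) m) := fun m => by
    refine Fin.cases ?_ (fun m' => ?_) m
    · rw [Fin.cons_zero]; exact measurableSet_distBall ρ
    · rw [Fin.cons_succ]; exact measurableSet_distBall δ
  refine (gibbs_chainEventAt_le u₀ h ha hθ hr Φ t hg hB).trans (le_of_eq ?_)
  rw [Fin.prod_univ_succ]
  simp only [Fin.cons_zero, Fin.cons_succ, Finset.prod_const, card_univ, Fintype.card_fin]

/-! ## Arithmetic in `ℝ≥0∞` -/

/-- The assembly of the two families: with `n · V_δ ≤ D_δ` and `n · V_ρ ≤ D_ρ`,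
`n^{r+1} 2^{r+2} V_ρ V_δ^r + (r+1) n^r 2^{r+1} V_δ^r ≤ 2^{r+2} D_δ^r (D_ρ + r + 1)`. -/
theorem nearChain_arith (r : ℕ) {n Vδ Vρ Dδ Dρ : ℝ≥0∞} (hδ : n * Vδ ≤ Dδ) (hρ : n * Vρ ≤ Dρ) :
    n ^ (r + 1) * (2 ^ (r + 2) * (Vρ * Vδ ^ r)) + (r + 1 : ℝ≥0∞) * n ^ r * (2 ^ (r + 1) * Vδ ^ r)
      ≤ 2 ^ (r + 2) * Dδ ^ r * (Dρ + r + 1) := by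
  have h2 : (2 : ℝ≥0∞) ^ (r + 1) ≤ 2 ^ (r + 2) := pow_le_pow_right₀ (by norm_num) (by omega)
  calc n ^ (r + 1) * (2 ^ (r + 2) * (Vρ * Vδ ^ r)) + (r + 1 : ℝ≥0∞) * n ^ r * (2 ^ (r + 1) * Vδ ^ r)
      = 2 ^ (r + 2) * (n * Vδ) ^ r * (n * Vρ) + 2 ^ (r + 1) * (n * Vδ) ^ r * (r + 1) := by ring
    _ ≤ 2 ^ (r + 2) * Dδ ^ r * Dρ + 2 ^ (r + 2) * Dδ ^ r * (r + 1) := by gcongr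
    _ = 2 ^ (r + 2) * Dδ ^ r * (Dρ + r + 1) := by ring

/-! ## The stub -/

/-- **Registered sub-stub `stub_nearChainBound` — RUELLE BOUND FOR NEAR-CONTACT CHAINS** (line
`slab-percolation-shadow`, crux stmt-AtomisticToContinuum-13916): under `SmallDensity uniformProfile σ`,
`a, θ > 0`, for `r + 1 ≤ N`, any flow `Φ`, time `t`, radii `0 ≤ δ, ρ < 1/2` and label `i`,
`G_N{NearChain N Φ t r δ ρ · i} ≤ 2^{r+2} (8(N+1)δ³)^r (8(N+1)ρ³ + r + 1)`: union over the injective label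
sequences, split by `i ∈ range f` (family (2), `≤ (r+1)(N+1)^r` sequences) or not (family (1), prepend `i`,
`≤ (N+1)^{r+1}` sequences), the landed fixed-time chain bound `gibbs_chainEventAt_le` for each, and the cube
comparison `vol(B_δ) ≤ 8δ³`. -/
theorem stub_nearChainBound : NearChainBound := by
  intro σ a θ u₀ h ha hθ N r hrN Φ t δ ρ hδ0 hδ hρ0 hρ i
  set G := gibbs σ a θ u₀ N Φ
  -- the two families of label sequences
  set S₁ : Finset (Fin (r + 1) → Fin (N + 1)) :=
    univ.filter fun f => Function.Injective f ∧ i ∉ Set.range f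
  set S₂ : Finset (Fin (r + 1) → Fin (N + 1)) :=
    univ.filter fun f => Function.Injective f ∧ ∃ p, f p = i
  -- their events
  set E₁ : (Fin (r + 1) → Fin (N + 1)) → Set (Phase N) := fun f =>
    {z : Phase N | ∀ m : Fin (r + 1),
        (Φ.flow t z ((Fin.cons i f : Fin (r + 2) → Fin (N + 1)) m.succ)).1
          - (Φ.flow t z ((Fin.cons i f : Fin (r + 2) → Fin (N + 1)) m.castSucc)).1
          ∈ (Fin.cons {u : T3 | Torus.euclidDist u 0 ≤ ρ} (fun _ => {u : T3 | Torus.euclidDist u 0 ≤ δ}) :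
              Fin (r + 1) → Set T3) m}
  set E₂ : (Fin (r + 1) → Fin (N + 1)) → Set (Phase N) := fun f =>
    {z : Phase N | ∀ m : Fin r,
        (Φ.flow t z (f m.succ)).1 - (Φ.flow t z (f m.castSucc)).1 ∈ {u : T3 | Torus.euclidDist u 0 ≤ δ}}
  -- covering of the near-chain event
  have hcover : {z | NearChain N Φ t r δ ρ z i} ⊆ (⋃ f ∈ S₁, E₁ f) ∪ ⋃ f ∈ S₂, E₂ f := by
    intro z hz
    obtain ⟨f, hf, hlink, hprox⟩ := hz
    by_cases hi : ∃ p, f p = i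
    · refine Or.inr (Set.mem_biUnion (show f ∈ S₂ from mem_filter.2 ⟨mem_univ _, hf, hi⟩) fun m => ?_)
      show Torus.euclidDist _ 0 ≤ δ
      rw [Torus.euclidDist, sub_zero]
      exact hlink m
    · have hi' : i ∉ Set.range f := fun ⟨p, hp⟩ => hi ⟨p, hp⟩
      refine Or.inl (Set.mem_biUnion (show f ∈ S₁ from mem_filter.2 ⟨mem_univ _, hf, hi'⟩) fun m => ?_)
      refine Fin.cases ?_ (fun m' => ?_) m
      · simp only [Fin.cons_succ, Fin.cons_zero, Fin.castSucc_zero]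
        show Torus.euclidDist _ 0 ≤ ρ
        rw [Torus.euclidDist, sub_zero]
        exact hprox
      · rw [← Fin.succ_castSucc]
        simp only [Fin.cons_succ]
        show Torus.euclidDist _ 0 ≤ δ
        rw [Torus.euclidDist, sub_zero]
        exact hlink m'
  -- the bounds on the two families
  have hE₁le : ∀ f ∈ S₁, G (E₁ f) ≤ 2 ^ (r + 2) * (volume {u : T3 | Torus.euclidDist u 0 ≤ ρ}
      * volume {u : T3 | Torus.euclidDist u 0 ≤ δ} ^ r) := fun f hf =>
    gibbs_consChainAt_le u₀ h ha hθ hrN Φ t δ ρ (mem_filter.1 hf).2.1 (mem_filter.1 hf).2.2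
  have hE₂le : ∀ f ∈ S₂, G (E₂ f) ≤ 2 ^ (r + 1) * volume {u : T3 | Torus.euclidDist u 0 ≤ δ} ^ r :=
    fun f hf => gibbs_deltaChainAt_le u₀ h ha hθ (Nat.le_of_succ_le hrN) Φ t δ (mem_filter.1 hf).2.1
  have hcard₁ : S₁.card ≤ (N + 1) ^ (r + 1) :=
    card_filter_seq_le N r fun f => Function.Injective f ∧ i ∉ Set.range f
  have hcard₂ : S₂.card ≤ (r + 1) * (N + 1) ^ r := card_filter_exists_apply_eq_le N r i
  have hVδ := natCast_succ_mul_volume_distBall_le N hδ0 hδ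
  have hVρ := natCast_succ_mul_volume_distBall_le N hρ0 hρ
  calc G {z | NearChain N Φ t r δ ρ z i}
      ≤ G ((⋃ f ∈ S₁, E₁ f) ∪ ⋃ f ∈ S₂, E₂ f) := measure_mono hcover
    _ ≤ G (⋃ f ∈ S₁, E₁ f) + G (⋃ f ∈ S₂, E₂ f) := measure_union_le _ _
    _ ≤ ∑ f ∈ S₁, G (E₁ f) + ∑ f ∈ S₂, G (E₂ f) :=
        add_le_add (measure_biUnion_finset_le S₁ E₁) (measure_biUnion_finset_le S₂ E₂)
    _ ≤ ∑ _f ∈ S₁, 2 ^ (r + 2) * (volume {u : T3 | Torus.euclidDist u 0 ≤ ρ}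
            * volume {u : T3 | Torus.euclidDist u 0 ≤ δ} ^ r)
          + ∑ _f ∈ S₂, 2 ^ (r + 1) * volume {u : T3 | Torus.euclidDist u 0 ≤ δ} ^ r :=
        add_le_add (Finset.sum_le_sum hE₁le) (Finset.sum_le_sum hE₂le)
    _ = (S₁.card : ℝ≥0∞) * (2 ^ (r + 2) * (volume {u : T3 | Torus.euclidDist u 0 ≤ ρ}
            * volume {u : T3 | Torus.euclidDist u 0 ≤ δ} ^ r))
          + (S₂.card : ℝ≥0∞) * (2 ^ (r + 1) * volume {u : T3 | Torus.euclidDist u 0 ≤ δ} ^ r) := by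
        rw [Finset.sum_const, Finset.sum_const, nsmul_eq_mul, nsmul_eq_mul]
    _ ≤ (((N + 1) ^ (r + 1) : ℕ) : ℝ≥0∞) * (2 ^ (r + 2) * (volume {u : T3 | Torus.euclidDist u 0 ≤ ρ}
            * volume {u : T3 | Torus.euclidDist u 0 ≤ δ} ^ r))
          + (((r + 1) * (N + 1) ^ r : ℕ) : ℝ≥0∞)
            * (2 ^ (r + 1) * volume {u : T3 | Torus.euclidDist u 0 ≤ δ} ^ r) := by
        gcongr
    _ = ((N : ℝ≥0∞) + 1) ^ (r + 1) * (2 ^ (r + 2) * (volume {u : T3 | Torus.euclidDist u 0 ≤ ρ}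
            * volume {u : T3 | Torus.euclidDist u 0 ≤ δ} ^ r))
          + ((r : ℝ≥0∞) + 1) * ((N : ℝ≥0∞) + 1) ^ r
            * (2 ^ (r + 1) * volume {u : T3 | Torus.euclidDist u 0 ≤ δ} ^ r) := by
        push_cast
        ring
    _ ≤ 2 ^ (r + 2) * ENNReal.ofReal (8 * (N + 1) * δ ^ 3) ^ r
          * (ENNReal.ofReal (8 * (N + 1) * ρ ^ 3) + r + 1) := nearChain_arith r hVδ hVρ

end

end Summit.AtomisticToContinuum.HydrodynamicLimit.Theorems.TrueAnchoredInfection
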